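import Summits.Parity.GeneralizedHardyLittlewood.Theses.GreenTaoLevelTwo
import Summits.Parity.GeneralizedHardyLittlewood.Theorems.GreenTaoLevelTwoGITwoCyclicToInterval
import Summits.Parity.GeneralizedHardyLittlewood.Theorems.GreenTaoLevelTwoGITwoCyclicInverse
import HarnessLib

/-!
# Route `GreenTaoLevelTwo` (Parity / GeneralizedHardyLittlewood), crux `GITwo` (stmt-Parity-21275): PROVED

The rank-2 crux `GITwo` of the route — `GI(2)` on `[N]` with inverse families in the Heisenberg class
`𝒞₂(H_d)` for every compatible box-comparable metric `d` on `H³(ℝ)/H³(ℤ)` (Green–Tao 2010 Prop. 8.4 /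
Conj. 8.3 at `s = 2`, datum `GreenTao2010_inverseDatum 2 δ 𝓜 M c`) — by the kernel-checked composition
of the birth skeleton `Cruxes/GITwo/Lines/birth.lean`: the transfer stub `stub_cyclicToInterval`
(`[N] ↪ ℤ/N'ℤ`, GT2010 App. B, landed p795643) applied to the XL stub `stub_cyclicInverse` (the inverse
theorem for `U³(ℤ/N'ℤ)` over the Heisenberg class, Green–Tao 2008a Thm. 12.8 = arXiv:math/0503014
Thm. 68, landed p819206 on top of ≈ 95 helper files formalising arXiv §§5–12).

* `GITwo_proof : GITwo`.

References: B. Green, T. Tao, *An inverse theorem for the Gowers `U³(G)` norm*, Proc. Edinb. Math. Soc.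
51 (2008) 73–153 [GreenTao2008U3Inverse]; B. Green, T. Tao, *Linear equations in primes*, Ann. of
Math. 171 (2010) 1753–1850, Prop. 8.4 and App. B [GreenTao2010].
-/

namespace Summit.Parity.GeneralizedHardyLittlewood.Theses.GreenTaoLevelTwo

/-- **Crux `GITwo` of route `GreenTaoLevelTwo` (stmt-Parity-21275), proved**: `GI(2)` on `[N]` with
inverse families in the Heisenberg class of `H_d`, for every compatible box-comparable metric `d`
(GT2010 Prop. 8.4), from the `U³(ℤ/N'ℤ)` inverse theorem `stub_cyclicInverse` (GT2008a Thm. 12.8) through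
the transfer `stub_cyclicToInterval` (GT2010 App. B).
[cite: GreenTao2008U3Inverse, Thm. 12.8] [cite: GreenTao2010, Prop. 8.4 and Lemma B.5] -/
theorem GITwo_proof : GITwo :=
  Summit.Parity.GeneralizedHardyLittlewood.GreenTaoLevelTwoGITwoCyclicToInterval.stub_cyclicToInterval
    Summit.Parity.GeneralizedHardyLittlewood.GreenTaoLevelTwoGITwoCyclicInverse.stub_cyclicInverse

end Summit.Parity.GeneralizedHardyLittlewood.Theses.GreenTaoLevelTwo
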